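import Literature.AnabelianGeometry.SemiGraphs.UniversalCoveringOver
import Literature.AnabelianGeometry.SemiGraphs.OrbitGraphMap
import Literature.AnabelianGeometry.SemiGraphs.OrbitGraphOrbits

/-!
# Rigidity of `𝒢_{∞,S}`: morphisms out of it are determined by one value ([SemiAnbd] §3 p. 38)

For an object `S` of `B^cov(𝒢)` and a base component `c` of `𝔾_S`, two morphisms
`φ, ψ : 𝒢_{∞,S} ⟶ X` of `B^cov(𝒢)` (`𝒢_{∞,S} = univCoverOver S c`, `UniversalCoveringOver.lean`)
which agree at ONE point of ONE fibre agree everywhere (`univCoverOver_hom_ext`).  This is the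
covering-space rigidity behind [SemiAnbd] p. 38 ("`Gal(𝒢_{∞,i}/𝒢_i) ≅ π₁(𝔾_i)`", the automorphism
groups being discrete and countable): every point `(V, x, p)` of `𝒢_{∞,S}` is reached from the
given one by the `Π_v`-actions (equivariance), the gluings along branches (compatibility) and their
inverses, following a zigzag representing the path class `p`.
-/

namespace Literature.AnabelianGeometry.SemiGraphs

namespace ProfiniteSemiGraph

open CategoryTheory

universe u

variable {𝒢 : ProfiniteSemiGraph.{u}} (S : CovObj 𝒢) (c : S.orbitGraph.CatCarrier)
  (h𝒢 : 𝒢.IsCountable) {X : CovObj 𝒢} (φ ψ : S.univCoverOver c h𝒢 ⟶ X)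

/-- `φ` and `ψ` agree on all points of `𝒢_{∞,S}` with path component `p : c ⟶ a` (a vertex-orbit
or an edge-orbit `a` of `𝔾_S`). [cite: MochizukiSemiAnbd2006, Prop 3.6 p.38] -/
def CovObj.AgreeAt : (a : Quiver.FreeGroupoid S.orbitGraph.CatCarrier) →
    (S.orbitGraph.basept c ⟶ a) → Prop
  | ⟨Sum.inl V⟩, p => ∀ (x : (S.SV (CovObj.OVertex.base S V)).obj.V)
      (hx : Quot.mk S.VRel ⟨_, x⟩ = V),
      (φ.fV _).hom.hom (⟨⟨V, rfl⟩, ⟨⟨x, hx⟩, p⟩⟩ : S.FibV c (CovObj.OVertex.base S V)) =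
        (ψ.fV _).hom.hom (⟨⟨V, rfl⟩, ⟨⟨x, hx⟩, p⟩⟩ : S.FibV c (CovObj.OVertex.base S V))
  | ⟨Sum.inr E⟩, q => ∀ (y : (S.SE (CovObj.OEdge.base S E)).obj.V)
      (hy : Quot.mk S.ERel ⟨_, y⟩ = E),
      (φ.fE _).hom.hom (⟨⟨E, rfl⟩, ⟨⟨y, hy⟩, q⟩⟩ : S.FibE c (CovObj.OEdge.base S E)) =
        (ψ.fE _).hom.hom (⟨⟨E, rfl⟩, ⟨⟨y, hy⟩, q⟩⟩ : S.FibE c (CovObj.OEdge.base S E))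

/-- Agreement on a vertex-orbit spreads along the `Π_v`-orbit: it suffices to check one point.
[cite: MochizukiSemiAnbd2006, Prop 3.6 p.38] -/
theorem CovObj.agreeAt_inl_of_one (V : S.OVertex) (p : S.orbitGraph.basept c ⟶ S.orbitGraph.basept (Sum.inl V))
    (x₀ : (S.SV (CovObj.OVertex.base S V)).obj.V) (hx₀ : Quot.mk S.VRel ⟨_, x₀⟩ = V)
    (h₀ : (φ.fV _).hom.hom (⟨⟨V, rfl⟩, ⟨⟨x₀, hx₀⟩, p⟩⟩ : S.FibV c (CovObj.OVertex.base S V)) =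
      (ψ.fV _).hom.hom (⟨⟨V, rfl⟩, ⟨⟨x₀, hx₀⟩, p⟩⟩ : S.FibV c (CovObj.OVertex.base S V))) :
    CovObj.AgreeAt S c h𝒢 φ ψ (S.orbitGraph.basept (Sum.inl V)) p := by
  intro x hx
  obtain ⟨g, hg⟩ := S.exists_ρ_of_mk_eq_mk (hx₀.trans hx.symm)
  have ht : (⟨⟨V, rfl⟩, ⟨⟨x, hx⟩, p⟩⟩ : S.FibV c (CovObj.OVertex.base S V)) =
      S.fibVAct c _ g ⟨⟨V, rfl⟩, ⟨⟨x₀, hx₀⟩, p⟩⟩ :=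
    CovObj.FibV.ext S c rfl hg.symm HEq.rfl
  rw [ht]
  exact (CovHom.fV_ρ φ _ g _).trans ((congrArg _ h₀).trans (CovHom.fV_ρ ψ _ g _).symm)

/-- The gluing of `X` is injective on points. [cite: MochizukiSemiAnbd2006, Def 3.5(i) p.37] -/
theorem CovObj.glue_injective (b : 𝒢.graph.Branch) (v : 𝒢.graph.Vertex)
    (h : 𝒢.graph.abuts b = some v) :
    Function.Injective (fun y : (X.SE (𝒢.graph.edgeOf b)).obj.V => (X.glue b v h).hom.hom.hom y) :=
  fun y y' hyy => by
    have := congrArg (fun z => (X.glue b v h).inv.hom.hom z) hyy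
    simpa only [CovObj.glue_inv_hom] using this

/-- Forward step: agreement on the edge-orbit `E` (path `q`) gives agreement on the vertex-orbit
`V` to which the branch of `E` over `b` abuts (path `q ≫ b̃`). [cite: MochizukiSemiAnbd2006, Prop 3.6 p.38] -/
theorem CovObj.agreeAt_forward (b : 𝒢.graph.Branch) (E : S.OEdge)
    (hE : CovObj.OEdge.base S E = 𝒢.graph.edgeOf b) (V : S.OVertex)
    (hv : S.orbitGraph.abuts ⟨(b, E), hE⟩ = some V)
    (q : S.orbitGraph.basept c ⟶ S.orbitGraph.basept (Sum.inr E))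
    (hq : CovObj.AgreeAt S c h𝒢 φ ψ (S.orbitGraph.basept (Sum.inr E)) q) :
    CovObj.AgreeAt S c h𝒢 φ ψ (S.orbitGraph.basept (Sum.inl V))
      (q ≫ S.orbitGraph.brArrow ⟨(b, E), hE⟩ E V rfl hv) := by
  -- the vertex under `V` and the abutment of `b`
  have h : 𝒢.graph.abuts b = some (CovObj.OVertex.base S V) :=
    S.orbitGraphProj.abuts_branchMap ⟨(b, E), hE⟩ V hv
  -- a representative of `E`
  revert hE hv q
  induction E using Quot.ind with
  | mk pr =>
  obtain ⟨e', y'⟩ := pr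
  intro hE
  cases hE
  intro hv q hq
  -- agreement at the edge point `(E, y', q)` and, by compatibility, at its gluing
  have h1 := hq y' rfl
  have hc := CovHom.glue_fE φ b _ h (⟨⟨Quot.mk _ ⟨_, y'⟩, rfl⟩, ⟨⟨y', rfl⟩, q⟩⟩ : S.FibE c _)
  have hc' := CovHom.glue_fE ψ b _ h (⟨⟨Quot.mk _ ⟨_, y'⟩, rfl⟩, ⟨⟨y', rfl⟩, q⟩⟩ : S.FibE c _)
  have hu₁ : (φ.fV _).hom.hom (((S.univCoverOver c h𝒢).glue b _ h).hom.hom.hom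
      (⟨⟨Quot.mk _ ⟨_, y'⟩, rfl⟩, ⟨⟨y', rfl⟩, q⟩⟩ : S.FibE c _)) =
      (ψ.fV _).hom.hom (((S.univCoverOver c h𝒢).glue b _ h).hom.hom.hom
      (⟨⟨Quot.mk _ ⟨_, y'⟩, rfl⟩, ⟨⟨y', rfl⟩, q⟩⟩ : S.FibE c _)) :=
    hc.symm.trans ((congrArg (fun z => (X.glue b _ h).hom.hom.hom z) h1).trans hc')
  -- the target orbit is the orbit of `glue y'`
  have hVV : V = Quot.mk _ ⟨_, (S.glue b _ h).hom.hom.hom y'⟩ :=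
    Option.some.inj (hv.symm.trans (S.orbitGraph_abuts_mk b _ h ⟨Quot.mk _ ⟨_, y'⟩, rfl⟩ y' rfl))
  refine S.agreeAt_inl_of_one c h𝒢 φ ψ V _ ((S.glue b _ h).hom.hom.hom y') hVV.symm ?_
  -- identify the point `(V, glue y', q ≫ b̃)` with the glued point
  have hpt : (⟨⟨V, rfl⟩, ⟨⟨(S.glue b _ h).hom.hom.hom y', hVV.symm⟩,
      q ≫ S.orbitGraph.brArrow ⟨(b, Quot.mk _ ⟨_, y'⟩), rfl⟩ _ V rfl hv⟩⟩ :
        S.FibV c (CovObj.OVertex.base S V)) =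
      ((S.univCoverOver c h𝒢).glue b _ h).hom.hom.hom
        (⟨⟨Quot.mk _ ⟨_, y'⟩, rfl⟩, ⟨⟨y', rfl⟩, q⟩⟩ : S.FibE c _) := by
    change _ = S.glueOverFun c b _ h _
    refine CovObj.FibV.ext S c (Subtype.ext hVV) rfl ?_
    have aux : ∀ (V₁ V₂ : S.OVertex) (e : V₁ = V₂)
        (h₁ : S.orbitGraph.abuts ⟨(b, Quot.mk _ ⟨_, y'⟩), rfl⟩ = some V₁)
        (h₂ : S.orbitGraph.abuts ⟨(b, Quot.mk _ ⟨_, y'⟩), rfl⟩ = some V₂),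
        HEq (q ≫ S.orbitGraph.brArrow ⟨(b, Quot.mk _ ⟨_, y'⟩), rfl⟩ _ V₁ rfl h₁)
          (q ≫ S.orbitGraph.brArrow ⟨(b, Quot.mk _ ⟨_, y'⟩), rfl⟩ _ V₂ rfl h₂) := by
      intro V₁ V₂ e h₁ h₂; subst e; rfl
    exact aux _ _ hVV _ _
  rw [hpt]
  exact hu₁

/-- Backward step: agreement on the vertex-orbit `V` (path `r`) gives agreement on an edge-orbit
`E` whose branch over `b` abuts to `V` (path `r ≫ b̃⁻¹`). [cite: MochizukiSemiAnbd2006, Prop 3.6 p.38] -/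
theorem CovObj.agreeAt_backward (b : 𝒢.graph.Branch) (E : S.OEdge)
    (hE : CovObj.OEdge.base S E = 𝒢.graph.edgeOf b) (V : S.OVertex)
    (hv : S.orbitGraph.abuts ⟨(b, E), hE⟩ = some V)
    (ρ : S.orbitGraph.basept (Sum.inl V) ⟶ S.orbitGraph.basept (Sum.inr E))
    (hρ : ρ ≫ S.orbitGraph.brArrow ⟨(b, E), hE⟩ E V rfl hv = 𝟙 _)
    (r : S.orbitGraph.basept c ⟶ S.orbitGraph.basept (Sum.inl V))
    (hr : CovObj.AgreeAt S c h𝒢 φ ψ (S.orbitGraph.basept (Sum.inl V)) r) :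
    CovObj.AgreeAt S c h𝒢 φ ψ (S.orbitGraph.basept (Sum.inr E)) (r ≫ ρ) := by
  have h : 𝒢.graph.abuts b = some (CovObj.OVertex.base S V) :=
    S.orbitGraphProj.abuts_branchMap ⟨(b, E), hE⟩ V hv
  revert hE hv ρ
  induction E using Quot.ind with
  | mk pr =>
  obtain ⟨e', y'⟩ := pr
  intro hE
  cases hE
  intro hv ρ hρ y hy
  -- the edge point and its gluing
  have hV2 : V = Quot.mk _ ⟨_, (S.glue b _ h).hom.hom.hom y⟩ :=
    Option.some.inj (hv.symm.trans (S.orbitGraph_abuts_mk b _ h ⟨Quot.mk _ ⟨_, y'⟩, rfl⟩ y hy))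
  have hpt : (⟨⟨V, rfl⟩, ⟨⟨(S.glue b _ h).hom.hom.hom y, hV2.symm⟩, r⟩⟩ :
        S.FibV c (CovObj.OVertex.base S V)) =
      ((S.univCoverOver c h𝒢).glue b _ h).hom.hom.hom
        (⟨⟨Quot.mk _ ⟨_, y'⟩, rfl⟩, ⟨⟨y, hy⟩, r ≫ ρ⟩⟩ : S.FibE c _) := by
    change _ = S.glueOverFun c b _ h _
    refine CovObj.FibV.ext S c (Subtype.ext hV2) rfl ?_
    have aux : ∀ (V₂ : S.OVertex) (e : V = V₂)
        (h₂ : S.orbitGraph.abuts ⟨(b, Quot.mk _ ⟨_, y'⟩), rfl⟩ = some V₂),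
        HEq r ((r ≫ ρ) ≫ S.orbitGraph.brArrow ⟨(b, Quot.mk _ ⟨_, y'⟩), rfl⟩ _ V₂ rfl h₂) := by
      intro V₂ e h₂
      subst e
      apply heq_of_eq
      rw [Category.assoc]
      exact ((congrArg (r ≫ ·) hρ).trans (Category.comp_id r)).symm
    exact aux _ hV2 _
  -- agreement of `φ_V`, `ψ_V` at the glued point, hence of `glue (φ_E t)` and `glue (ψ_E t)`
  have h1 := hr ((S.glue b _ h).hom.hom.hom y) hV2.symm
  rw [hpt] at h1
  have hc := CovHom.glue_fE φ b _ h (⟨⟨Quot.mk _ ⟨_, y'⟩, rfl⟩, ⟨⟨y, hy⟩, r ≫ ρ⟩⟩ : S.FibE c _)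
  have hc' := CovHom.glue_fE ψ b _ h (⟨⟨Quot.mk _ ⟨_, y'⟩, rfl⟩, ⟨⟨y, hy⟩, r ≫ ρ⟩⟩ : S.FibE c _)
  exact CovObj.glue_injective b _ h (hc.trans (h1.trans hc'.symm))

/-- The class of the reversed arrow of a branch followed by the class of the arrow is the identity
(the defining relation of the free groupoid). [cite: MochizukiSemiAnbd2006, Def. 2.11 p.32] -/
private theorem map_reverse_comp_brArrow (bt : S.orbitGraph.Branch) (E : S.orbitGraph.Edge)
    (V : S.orbitGraph.Vertex) (he : S.orbitGraph.edgeOf bt = E) (hv : S.orbitGraph.abuts bt = some V) :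
    ((CategoryTheory.Quotient.functor
        (@Quiver.FreeGroupoid.redStep S.orbitGraph.CatCarrier S.orbitGraph.catQuiver)).map
      (@Quiver.Hom.toPath (Quiver.Symmetrify S.orbitGraph.CatCarrier)
        (@Quiver.symmetrifyQuiver _ S.orbitGraph.catQuiver) (Sum.inl V) (Sum.inr E)
        (Sum.inr (⟨bt, he, hv⟩ : SemiGraph.CatArrow (Sum.inr E) (Sum.inl V)))) :
      S.orbitGraph.basept (Sum.inl V) ⟶ S.orbitGraph.basept (Sum.inr E)) ≫
      S.orbitGraph.brArrow bt E V he hv = 𝟙 _ := by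
  have h := CategoryTheory.Quotient.sound
    (@Quiver.FreeGroupoid.redStep S.orbitGraph.CatCarrier S.orbitGraph.catQuiver)
    (@Quiver.FreeGroupoid.redStep.step S.orbitGraph.CatCarrier S.orbitGraph.catQuiver
      (Sum.inl V) (Sum.inr E) (Sum.inr (⟨bt, he, hv⟩ : SemiGraph.CatArrow (Sum.inr E) (Sum.inl V))))
  rw [CategoryTheory.Functor.map_id, CategoryTheory.Functor.map_comp] at h
  exact h.symm

/-- One zigzag step of the transport of agreement. [cite: MochizukiSemiAnbd2006, Prop 3.6 p.38] -/
private theorem agreeAt_step (y z : S.orbitGraph.CatCarrier)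
    (g : @Quiver.Hom (Quiver.Symmetrify S.orbitGraph.CatCarrier)
      (@Quiver.symmetrifyQuiver _ S.orbitGraph.catQuiver) y z)
    (r : S.orbitGraph.basept c ⟶ S.orbitGraph.basept y)
    (hr : CovObj.AgreeAt S c h𝒢 φ ψ (S.orbitGraph.basept y) r) :
    CovObj.AgreeAt S c h𝒢 φ ψ (S.orbitGraph.basept z) (r ≫
      (CategoryTheory.Quotient.functor
        (@Quiver.FreeGroupoid.redStep S.orbitGraph.CatCarrier S.orbitGraph.catQuiver)).map
        (@Quiver.Hom.toPath (Quiver.Symmetrify S.orbitGraph.CatCarrier)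
          (@Quiver.symmetrifyQuiver _ S.orbitGraph.catQuiver) y z g)) := by
  revert g r
  refine Sum.rec (fun V => ?_) (fun E => ?_) y <;> refine Sum.rec (fun V' => ?_) (fun E' => ?_) z
    <;> intro g r hr <;> rcases g with g | g
  · exact g.elim
  · exact g.elim
  · exact g.elim
  · -- reversed arrow `V ⟵ E'`: `g = (bt : E' → V)`
    obtain ⟨⟨⟨b, E₀⟩, hE₀⟩, he, hv⟩ := g
    change E₀ = E' at he
    subst he
    exact S.agreeAt_backward c h𝒢 φ ψ b E₀ hE₀ V hv _
      (map_reverse_comp_brArrow S ⟨(b, E₀), hE₀⟩ E₀ V rfl hv) r hr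
  · -- arrow `E → V'`: `g = (bt : E → V')`
    obtain ⟨⟨⟨b, E₀⟩, hE₀⟩, he, hv⟩ := g
    change E₀ = E at he
    subst he
    exact S.agreeAt_forward c h𝒢 φ ψ b E₀ hE₀ V' hv r hr
  · exact g.elim
  · exact g.elim
  · exact g.elim

/-- Transport of agreement along any morphism of the fundamental groupoid of `𝔾_S`.
[cite: MochizukiSemiAnbd2006, Prop 3.6 p.38] -/
theorem CovObj.agreeAt_transport {a a' : Quiver.FreeGroupoid S.orbitGraph.CatCarrier}
    (f : a ⟶ a') (p : S.orbitGraph.basept c ⟶ a) (hp : CovObj.AgreeAt S c h𝒢 φ ψ a p) :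
    CovObj.AgreeAt S c h𝒢 φ ψ a' (p ≫ f) := by
  revert p
  refine CategoryTheory.Quotient.induction
    (r := @Quiver.FreeGroupoid.redStep S.orbitGraph.CatCarrier S.orbitGraph.catQuiver)
    (P := fun {x y} f => ∀ (p : S.orbitGraph.basept c ⟶ x), CovObj.AgreeAt S c h𝒢 φ ψ x p →
      CovObj.AgreeAt S c h𝒢 φ ψ y (p ≫ f)) ?_ f
  intro x' y' path
  induction path with
  | nil =>
    intro p hp
    have hid : (CategoryTheory.Quotient.functor
        (@Quiver.FreeGroupoid.redStep S.orbitGraph.CatCarrier S.orbitGraph.catQuiver)).map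
          (𝟙 ((Paths.of (Quiver.Symmetrify S.orbitGraph.CatCarrier)).obj x')) = 𝟙 _ :=
      CategoryTheory.Functor.map_id _ _
    exact hid ▸ (Category.comp_id p).symm ▸ hp
  | cons path g ih =>
    intro p hp
    rename_i y'' z
    have hcons : (CategoryTheory.Quotient.functor
        (@Quiver.FreeGroupoid.redStep S.orbitGraph.CatCarrier S.orbitGraph.catQuiver)).map
          (@Quiver.Path.cons (Quiver.Symmetrify S.orbitGraph.CatCarrier)
            (@Quiver.symmetrifyQuiver _ S.orbitGraph.catQuiver) x' y'' z path g) =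
        (CategoryTheory.Quotient.functor
          (@Quiver.FreeGroupoid.redStep S.orbitGraph.CatCarrier S.orbitGraph.catQuiver)).map path ≫
        (CategoryTheory.Quotient.functor
          (@Quiver.FreeGroupoid.redStep S.orbitGraph.CatCarrier S.orbitGraph.catQuiver)).map
          (@Quiver.Hom.toPath (Quiver.Symmetrify S.orbitGraph.CatCarrier)
            (@Quiver.symmetrifyQuiver _ S.orbitGraph.catQuiver) y'' z g) := by
      rw [← CategoryTheory.Functor.map_comp]
      rfl
    have key : (p ≫ (CategoryTheory.Quotient.functor
          (@Quiver.FreeGroupoid.redStep S.orbitGraph.CatCarrier S.orbitGraph.catQuiver)).map path) ≫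
        (CategoryTheory.Quotient.functor
          (@Quiver.FreeGroupoid.redStep S.orbitGraph.CatCarrier S.orbitGraph.catQuiver)).map
          (@Quiver.Hom.toPath (Quiver.Symmetrify S.orbitGraph.CatCarrier)
            (@Quiver.symmetrifyQuiver _ S.orbitGraph.catQuiver) y'' z g) =
        p ≫ (CategoryTheory.Quotient.functor
          (@Quiver.FreeGroupoid.redStep S.orbitGraph.CatCarrier S.orbitGraph.catQuiver)).map
          (@Quiver.Path.cons (Quiver.Symmetrify S.orbitGraph.CatCarrier)
            (@Quiver.symmetrifyQuiver _ S.orbitGraph.catQuiver) x' y'' z path g) := by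
      rw [hcons]; exact Category.assoc _ _ _
    exact key ▸ agreeAt_step S c h𝒢 φ ψ y'' z g _ (ih p hp)

/-- **Rigidity of `𝒢_{∞,S}`: two morphisms `𝒢_{∞,S} ⟶ X` of `B^cov(𝒢)` which agree at one point
of one vertex fibre are equal.** [cite: MochizukiSemiAnbd2006, Prop 3.6 p.38] -/
theorem CovObj.univCoverOver_hom_ext {v₀ : 𝒢.graph.Vertex} (t₀ : S.FibV c v₀)
    (h₀ : (φ.fV v₀).hom.hom t₀ = (ψ.fV v₀).hom.hom t₀) : φ = ψ := by
  -- agreement on the orbit of `t₀`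
  cases t₀ with | mk V₀' xp =>
  cases xp with | mk xx p₀ =>
  cases xx with | mk x₀ hx₀ =>
  cases V₀' with | mk V₀ hV₀ =>
  change CovObj.OVertex.base S V₀ = v₀ at hV₀
  subst hV₀
  have base : CovObj.AgreeAt S c h𝒢 φ ψ (S.orbitGraph.basept (Sum.inl V₀)) p₀ :=
    S.agreeAt_inl_of_one c h𝒢 φ ψ V₀ p₀ x₀ hx₀ h₀
  -- transport to every point
  refine CovHom.ext (funext fun v => ?_) (funext fun e => ?_)
  · apply ObjectProperty.hom_ext
    apply Action.Hom.ext
    apply ConcreteCategory.hom_ext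
    intro t
    cases t with | mk V' xq =>
    cases xq with | mk xx' p =>
    cases xx' with | mk x hx =>
    cases V' with | mk V hV =>
    change CovObj.OVertex.base S V = v at hV
    subst hV
    have hA := S.agreeAt_transport c h𝒢 φ ψ (inv p₀ ≫ p) p₀ base
    have e : p₀ ≫ (inv p₀ ≫ p) = p := by rw [← Category.assoc, IsIso.hom_inv_id, Category.id_comp]
    rw [e] at hA
    exact hA x hx
  · apply ObjectProperty.hom_ext
    apply Action.Hom.ext
    apply ConcreteCategory.hom_ext
    intro t
    cases t with | mk E' yq =>
    cases yq with | mk yy q =>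
    cases yy with | mk y hy =>
    cases E' with | mk E hE =>
    change CovObj.OEdge.base S E = e at hE
    subst hE
    have hA := S.agreeAt_transport c h𝒢 φ ψ (inv p₀ ≫ q) p₀ base
    have e : p₀ ≫ (inv p₀ ≫ q) = q := by rw [← Category.assoc, IsIso.hom_inv_id, Category.id_comp]
    rw [e] at hA
    exact hA y hy

end ProfiniteSemiGraph

end Literature.AnabelianGeometry.SemiGraphs
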